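import Literature.AlgebraicGeometry.Frobenioids.FiniteEtaleBase
import Literature.AlgebraicGeometry.Frobenioids.ArchimedeanBaseComparison
import HarnessLib

/-!
# Frobenioids II, Definition 3.1 (v) for the base `D₀` of §3: `D₀` is complexifiable, RC-connected, of FSMFF-type (PROOFS)

Mochizuki, *The geometry of Frobenioids II*, Kyushu J. Math. **62** (2008) 401–460, §3, Definition 3.1 (v),
pp. 24–25 (complexifiable, RC-connected, …) and the standing sentence p. 23 "`D₀` is a connected, totally
epimorphic category, which is of FSM-, hence also of FSMFF-type" [cite: MochizukiFrdII2008, Def 3.1 (v) pp.24-25].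

PROOF-ONLY companion (no definitions) of
abc-iut-L1-t4's `FiniteEtaleBase.lean` (the `RC.*` predicates of Def. 3.1 (v)) for abc-iut-L1-t6's skeleton
`ArchFrd.D0` of `D₀` viewed over `ArchBase = FinEtale ℝ` through the comparison functor
`ArchFrd.D0.toArchBase` (`ArchimedeanBaseComparison.lean`): these are the three ANTECEDENTS of [FrdII]
Prop. 3.4 (viii) at `π = 𝟭 D₀` (abc-iut-L1-t6's `ArchFrd.Tower.PropVIII`; abc-iut-L1-lead ruling R37 (A),
consumer abc-iut-L1-d3):

* `ArchFrd.D0.rc_isComplexifiable` — `D₀` is complexifiable: the only real object `Spec ℝ` receives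
  `Spec ℂ → Spec ℝ` with the automorphism complex conjugation of `Spec ℂ` over it, which is not the identity;
* `ArchFrd.D0.rc_isRCConnected` — `D₀` is RC-connected: connected, and `D₀[ℝ] = {Spec ℝ}`, `D₀[ℂ] = {Spec ℂ}`
  are (one-object, hence) connected;
* `ArchFrd.D0.isOfFSMFFType` — of FSMFF-type (from t6's `D0.isOfFSMType`);
and the same three facts for the literal base functor `𝟭 D₀ ⋙ toArchBase` of the tower at `π = 𝟭 D₀`.
-/

namespace Literature.AlgebraicGeometry.Frobenioids

open CategoryTheory

namespace ArchFrd

namespace D0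

/-- Every object of `D₀` maps to `Spec ℝ`. [cite: MochizukiFrdII2008, §3 p.23] -/
theorem zigzag_real (K : D0) : Zigzag K real := by
  cases K
  · exact Zigzag.refl _
  · exact Zigzag.of_hom toRealHom

/-- "`D₀` is a connected … category" (FrdII p. 23), as Mathlib's `IsConnected`.
[cite: MochizukiFrdII2008, §3 p.23] -/
theorem isConnected_D0 : IsConnected D0 := by
  haveI : Nonempty D0 := ⟨real⟩
  exact zigzag_isConnected fun X Y => (zigzag_real X).trans (zigzag_real Y).symm

/-- **`D₀` is complexifiable** (FrdII Def. 3.1 (v), p. 25: "for every `A ∈ Ob(F[ℝ])`, there exists a morphism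
`B → A` …, `B ∈ Ob(F[ℂ])`, together with an automorphism `β ∈ Aut_{F_A}(B)` that projects to the unique
nontrivial automorphism of `D₀`") — for `F = D₀` itself: `Spec ℂ → Spec ℝ` with `β =` complex conjugation.
[cite: MochizukiFrdII2008, Def 3.1 (v) p.25] -/
theorem rc_isComplexifiable : RC.IsComplexifiable toArchBase := by
  refine ⟨fun A hA => ?_⟩
  have hAr : A.IsReal := (isReal_toArchBase_iff A).mp hA
  cases A with
  | complex => exact absurd hAr (by decide)
  | real =>
    -- `β :=` complex conjugation as an automorphism of `Spec ℂ` (`conj ∘ conj = id`)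
    exact ⟨complex, toRealHom, ⟨conj, conj, conj_comp_conj, conj_comp_conj⟩,
      (isComplex_toArchBase_iff complex).mpr rfl, Subsingleton.elim _ _, toArchBase_map_conj_ne_id⟩

/-- **`D₀` is RC-connected** (FrdII Def. 3.1 (v), p. 25: "`F` is connected, and, moreover, the categories
`F[ℝ]`, `F[ℂ]` are either empty or connected") — for `F = D₀`: `D₀[ℝ] = {Spec ℝ}`, `D₀[ℂ] = {Spec ℂ}`.
[cite: MochizukiFrdII2008, Def 3.1 (v) p.25] -/
theorem rc_isRCConnected : RC.IsRCConnected toArchBase := by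
  refine ⟨isConnected_D0, Or.inr ?_, Or.inr ?_⟩
  · haveI : Nonempty (RC.RealPart toArchBase) := ⟨⟨real, (isReal_toArchBase_iff real).mpr rfl⟩⟩
    refine zigzag_isConnected fun X Y => ?_
    obtain ⟨A, hA⟩ := X
    obtain ⟨B, hB⟩ := Y
    have hA' : A = real := (isReal_toArchBase_iff A).mp hA
    have hB' : B = real := (isReal_toArchBase_iff B).mp hB
    subst hA'
    subst hB'
    exact Zigzag.refl _
  · haveI : Nonempty (RC.ComplexPart toArchBase) := ⟨⟨complex, (isComplex_toArchBase_iff complex).mpr rfl⟩⟩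
    refine zigzag_isConnected fun X Y => ?_
    obtain ⟨A, hA⟩ := X
    obtain ⟨B, hB⟩ := Y
    have hA' : A = complex := (isComplex_toArchBase_iff A).mp hA
    have hB' : B = complex := (isComplex_toArchBase_iff B).mp hB
    subst hA'
    subst hB'
    exact Zigzag.refl _

/-- "`D₀` … is of FSM-, hence also of FSMFF-type" (FrdII p. 23) for the skeleton (from abc-iut-L1-t6's
`D0.isOfFSMType`). [cite: MochizukiFrdII2008, §3 p.23] -/
theorem isOfFSMFFType : IsOfFSMFFType D0 := isOfFSMType.isOfFSMFFType

/-! ### The same facts for the base functor `𝟭 D₀ ⋙ toArchBase` of the tower at `π = 𝟭 D₀` -/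

/-- `D₀` over itself (`π = 𝟭 D₀`) is complexifiable — the first antecedent of [FrdII] Prop. 3.4 (viii) at
`π = 𝟭 D₀` in abc-iut-L1-t6's typing `ArchFrd.Tower.PropVIII`. [cite: MochizukiFrdII2008, Prop 3.4 (viii) p.30] -/
theorem rc_isComplexifiable_id_comp : RC.IsComplexifiable (𝟭 D0 ⋙ toArchBase) := by
  rw [Functor.id_comp]
  exact rc_isComplexifiable

/-- `D₀` over itself is RC-connected — the second antecedent of Prop. 3.4 (viii) at `π = 𝟭 D₀`.
[cite: MochizukiFrdII2008, Prop 3.4 (viii) p.30] -/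
theorem rc_isRCConnected_id_comp : RC.IsRCConnected (𝟭 D0 ⋙ toArchBase) := by
  rw [Functor.id_comp]
  exact rc_isRCConnected

end D0

end ArchFrd

end Literature.AlgebraicGeometry.Frobenioids
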